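import Literature.Analysis.FluidPDE.DeRosaGluingStability
import Literature.Analysis.FluidPDE.DeRosaThreeStages
import HarnessLib

/-!
# De Rosa's gluing stage reduced to three published inputs

L. De Rosa, *Infinitely many Leray–Hopf solutions for the fractional Navier–Stokes equations*,
Comm. PDE 44 (2019) 335–365 = arXiv:1801.10235, §5.2. The named fact `DeRosa.gluingStage`
(`DeRosaThreeStages.lean`: from the mollified triple `(v_ℓ, p_ℓ, R̊_ℓ)` with (5.6)–(5.7′) and a
spatial Hölder bound, a smooth solution `(v̄_q, p̄_q, R̊̄_q)` of the fractional NSR system with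
(5.13)|₀, (5.15)–(5.18), stress supported on the glue intervals, `v̄_q(·,0) = v_ℓ(·,0)`) is here
**reduced to three published inputs**, everything else in the printed §5.2 being proved in the
tree (`DeRosaGluedTriple`, `…Velocity`, `…Energy`, `…StressSize`, `…StressTransport`,
`…StageAssembly`, `DeRosaGluingStability`):

* `DeRosa.gluingStage_of_localExistence_of_potentialBounds_of_commutatorCZBound` — the three
  inputs, stated inline as hypotheses (no new named fact is introduced):
  1. **local existence** for the fractional Navier–Stokes equations with smooth periodic data
     (De Rosa Prop. 3.5, existence clause: "For any `ν > 0` and any `0 < α < 1` there exists a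
     constant `c = c(α) > 0` with the following property. Given any initial data `u₀ ∈ C^∞`, and
     `T ≤ c‖u₀‖_{1+α}⁻¹`, there exists a unique solution `v : ℝ³ × [0,T] → ℝ³` of (3.8)", proved
     from Thm. 3.4 = Majda–Bertozzi Thm. 3.4 by the energy method; here: a smooth exact solution on
     `[t₀, t₀ + T'] × 𝕋³` with `v(t₀) = u₀`, `div u₀ = 0`, whenever `T'‖u₀‖_{1,α} ≤ c(α, γ)`);
  2. **the vector-potential bounds of Prop. 5.4** for two consecutive exact solutions, in the
     currency `BDSV.PotentialBounds` of the scheme ((5.23)–(5.24) on the common life span; the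
     De Rosa twin of the second half of `BDSV.gluingStability`, BDSV Prop. 3.4);
  3. **the commutator estimate** `BDSV.commutatorCZBound` (BDSV App. D, Prop. D.1).
  The proof is De Rosa's §5.2 as assembled in the tree: the CFL condition (5.8) makes 1. produce
  the exact solutions `vᵢ` on the forward life spans `[tᵢ, tᵢ + 2τ_q] ∩ [0,T]` anchored at
  `v_ℓ(tᵢ)`; Cor. 5.2 and Prop. 5.3 are `DeRosa.stabilityBounds_of_exact`; 2. gives Prop. 5.4;
  and `DeRosa.gluedTriple_of_commutatorCZBound` glues (Prop. 5.5 and the fractional NSR system of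
  the glued triple).
* `BDSV.StabilityBounds.mono_const`, `BDSV.PotentialBounds.mono_const` — enlarging the constant.

## References

* L. De Rosa, Comm. PDE 44 (2019) = arXiv:1801.10235, §3.2 (Thm. 3.4, Prop. 3.5), §5.2
  ((5.7)–(5.9), Cor. 5.2, Props. 5.3–5.5, the glued triple). [`Derosa2018`]
* T. Buckmaster, C. De Lellis, L. Székelyhidi Jr., V. Vicol, CPAM 72 (2019) = arXiv:1701.08678,
  §2.5, §3 (Prop. 3.4), §4, App. D Prop. D.1. [`BuckmasterEtAl2018`]
* A. J. Majda, A. L. Bertozzi, *Vorticity and incompressible flow*, CUP (2002), Thm. 3.4.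
-/

noncomputable section

open MeasureTheory Set Filter Topology Function
open scoped NNReal ENNReal ContDiff

namespace Literature.Analysis.FluidPDE

/-! ## Enlarging the constants of the stability predicates -/

namespace BDSV

open FunctionSpaces FunctionSpaces.Torus

variable {β α a b T C C' : ℝ} {q Nbar i : ℕ}
  {vℓ : ℝ → UnitAddTorus (Fin 3) → EuclideanSpace ℝ (Fin 3)} {pℓ : ℝ → UnitAddTorus (Fin 3) → ℝ}
  {v v' : ℝ → UnitAddTorus (Fin 3) → EuclideanSpace ℝ (Fin 3)} {p : ℝ → UnitAddTorus (Fin 3) → ℝ}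

/-- The bounds of Cor. 3.2/Prop. 3.3 with constant `C` imply those with any `C' ≥ C` (`a ≥ 1`, so
that the parameter products are non-negative). [folklore] -/
theorem StabilityBounds.mono_const (h : StabilityBounds β α a b T C q Nbar i vℓ pℓ v p) (ha : 1 ≤ a)
    (hC : C ≤ C') : StabilityBounds β α a b T C' q Nbar i vℓ pℓ v p := by
  have hτ := (glueScale_pos (β := β) (α := α) (b := b) ha q).le
  have hℓ := (mollScale_pos (β := β) (α := α) (b := b) ha q).le
  have hδ := (amp_pos (β := β) (b := b) ha (q + 1)).le
  refine ⟨fun N h1 hN => (h.velocity N h1 hN).mono ?_, fun N hN => (h.velocity_sub N hN).mono ?_,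
    fun N hN => (h.pressure N hN).mono ?_, fun N hN => (h.transport N hN).mono ?_⟩
  · exact mul_le_mul_of_nonneg_right hC (mul_nonneg (inv_nonneg.2 hτ) (Real.rpow_nonneg hℓ _))
  · exact mul_le_mul_of_nonneg_right hC (by positivity)
  · exact mul_le_mul_of_nonneg_right hC (by positivity)
  · exact mul_le_mul_of_nonneg_right hC (by positivity)

/-- The bounds of Prop. 3.4 with constant `C` imply those with any `C' ≥ C` (`a ≥ 1`). [folklore] -/
theorem PotentialBounds.mono_const (h : PotentialBounds β α a b T C q Nbar i vℓ v v') (ha : 1 ≤ a)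
    (hC : C ≤ C') : PotentialBounds β α a b T C' q Nbar i vℓ v v' := by
  have hτ := (glueScale_pos (β := β) (α := α) (b := b) ha q).le
  have hℓ := (mollScale_pos (β := β) (α := α) (b := b) ha q).le
  have hδ := (amp_pos (β := β) (b := b) ha (q + 1)).le
  refine ⟨fun N hN => (h.potential N hN).mono ?_, fun N hN => (h.transport N hN).mono ?_⟩
  · exact mul_le_mul_of_nonneg_right hC (by positivity)
  · exact mul_le_mul_of_nonneg_right hC (by positivity)

end BDSV

namespace DeRosa

open FunctionSpaces FunctionSpaces.Torus
open BDSV hiding IsGlueFamily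

/-! ## The reduction -/

section Reduction

/-- **De Rosa's gluing stage from local existence, Prop. 5.4 and the commutator estimate.** The
named fact `DeRosa.gluingStage` (§5.2: the glued triple with (5.13)|₀, (5.15)–(5.18)) follows from
(1) the existence clause of De Rosa Prop. 3.5 (local existence of smooth solutions of the
fractional Navier–Stokes equations (3.8) = (5.9) with smooth divergence-free periodic data `u₀` on
`[t₀, t₀ + T'] × 𝕋³` for `T'‖u₀‖_{1,α} ≤ c(α,γ)`; "For any `ν > 0` and any `0 < α < 1` there exists
a constant `c = c(α) > 0` … Given any initial data `u₀ ∈ C^∞`, and `T ≤ c‖u₀‖_{1+α}⁻¹`, there exists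
a unique solution"), (2) the bounds of Prop. 5.4 on the vector potentials of two consecutive exact
solutions in the currency `BDSV.PotentialBounds` ("For `0 ≤ t - tᵢ ≤ 2τ_q`,
`‖zᵢ - zᵢ₊₁‖_{N+α} ≲ τ_qδ_{q+1}ℓ^{-N+α}`, `‖D_{t,ℓ}(zᵢ - zᵢ₊₁)‖_{N+α} ≲ δ_{q+1}ℓ^{-N+α}`"), and
(3) `BDSV.commutatorCZBound` (BDSV App. D, Prop. D.1). Proof = §5.2: by the CFL condition (5.8)
(`2τ_q‖v_ℓ‖_{1+α} ≲ ℓ^α ≪ 1`, thresholds `DeRosa.exists_threshold_cfl`,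
`BDSV.eContDiffHolderNorm_one_le_of_holderSupLE`) input (1) yields the exact solutions on the life
spans `S_j = [jτ_q - τ_q, jτ_q + τ_q] ∩ [0,T]` anchored at `v_ℓ` at their left endpoints; Cor. 5.2
and Prop. 5.3 are `DeRosa.stabilityBounds_of_exact`; (2) gives Prop. 5.4; the glued triple and
Prop. 5.5 are `DeRosa.gluedTriple_of_commutatorCZBound`. Thresholds: `α₀` the minimum of `1` and
those of the three ingredients; `a₀` the maximum of theirs and of the CFL threshold.
[cite: Derosa2018, §5.2 (Cor. 5.2, Props. 5.3–5.5, (5.8)–(5.9)) and §3.2 Prop. 3.5] -/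
theorem gluingStage_of_localExistence_of_potentialBounds_of_commutatorCZBound
    (hloc : ∀ α : ℝ, 0 < α → α < 1 → ∀ γ : ℝ, 0 < γ → γ < 1 → ∃ c : ℝ, 0 < c ∧
      ∀ ν : ℝ, 0 < ν → ∀ (t₀ : ℝ) (u₀ : UnitAddTorus (Fin 3) → EuclideanSpace ℝ (Fin 3)),
        IsSmooth u₀ → IsDivFree u₀ → ∀ K : ℝ, 0 ≤ K →
          Torus.eContDiffHolderNorm 1 (Real.toNNReal α) u₀ ≤ ENNReal.ofReal K →
          ∀ T' : ℝ, 0 < T' → T' * K ≤ c →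
            ∃ (v : ℝ → UnitAddTorus (Fin 3) → EuclideanSpace ℝ (Fin 3)) (p : ℝ → UnitAddTorus (Fin 3) → ℝ),
              Torus.IsFracNSReynoldsOn (Icc t₀ (t₀ + T')) γ ν v p (fun _ _ _ => 0) ∧ v t₀ = u₀)
    (hpot : ∀ β : ℝ, 0 < β → β < 1 / 3 → ∀ γ : ℝ, 0 < γ → γ < β →
      ∀ b : ℝ, 1 < b → b < (1 - β) / (2 * β) →
        ∃ α₀ : ℝ, 0 < α₀ ∧ ∀ α : ℝ, 0 < α → α < α₀ → ∀ (Nbar : ℕ) (Cin : ℕ → ℝ),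
          ∃ (C a₀ : ℝ), 1 < a₀ ∧ ∀ a : ℝ, a₀ ≤ a → ∀ ν : ℝ, 0 < ν → ν < 1 → ∀ T : ℝ, 0 < T →
            ∀ (q : ℕ) (vℓ : ℝ → UnitAddTorus (Fin 3) → EuclideanSpace ℝ (Fin 3))
              (pℓ : ℝ → UnitAddTorus (Fin 3) → ℝ) (Rℓ : ℝ → UnitAddTorus (Fin 3) → Fin 3 → EuclideanSpace ℝ (Fin 3)),
              Torus.IsFracNSReynoldsOn (Icc 0 T) γ ν vℓ pℓ Rℓ →
              (∀ N : ℕ, HolderSupLE T vℓ (N + 1) 0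
                (Cin N * (Real.sqrt (amp β a b q) * freq a b q * mollScale β α a b q ^ (-(N : ℝ))))) →
              (∀ N : ℕ, HolderSupLE T Rℓ N (Real.toNNReal α)
                (Cin N * (amp β a b (q + 1) * mollScale β α a b q ^ (-(N : ℝ) + α)))) →
              ∀ (i : ℕ) (v : ℝ → UnitAddTorus (Fin 3) → EuclideanSpace ℝ (Fin 3)) (p : ℝ → UnitAddTorus (Fin 3) → ℝ)
                (v' : ℝ → UnitAddTorus (Fin 3) → EuclideanSpace ℝ (Fin 3)) (p' : ℝ → UnitAddTorus (Fin 3) → ℝ),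
                ((i + 1 : ℕ) : ℝ) * glueScale β α a b q ≤ T →
                Torus.IsFracNSReynoldsOn (glueInterval T (glueScale β α a b q) i) γ ν v p (fun _ _ _ => 0) →
                v (max ((i : ℝ) * glueScale β α a b q - glueScale β α a b q) 0) =
                  vℓ (max ((i : ℝ) * glueScale β α a b q - glueScale β α a b q) 0) →
                Torus.IsFracNSReynoldsOn (glueInterval T (glueScale β α a b q) (i + 1)) γ ν v' p' (fun _ _ _ => 0) →
                v' (max (((i + 1 : ℕ) : ℝ) * glueScale β α a b q - glueScale β α a b q) 0) =
                  vℓ (max (((i + 1 : ℕ) : ℝ) * glueScale β α a b q - glueScale β α a b q) 0) →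
                  PotentialBounds β α a b T C q Nbar i vℓ v v')
    (hcomm : commutatorCZBound) : gluingStage := by
  intro M _ β hβ hβ3 γ hγ hγβ b hb hb' _ θ hθγ hθβ
  have hγ1 : γ < 1 := by linarith
  obtain ⟨α₇, hα₇, h7⟩ := stabilityBounds_of_exact β hβ hβ3 γ hγ hγβ b hb hb'
  obtain ⟨α₅, hα₅, h5⟩ := hpot β hβ hβ3 γ hγ hγβ b hb hb'
  obtain ⟨α₆, hα₆, h6⟩ := gluedTriple_of_commutatorCZBound hcomm β hβ hβ3 γ hγ hγβ b hb hb' θ hθγ hθβ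
  refine ⟨min 1 (min α₇ (min α₅ α₆)), lt_min one_pos (lt_min hα₇ (lt_min hα₅ hα₆)), fun α hα hαlt Nbar Cin CH => ?_⟩
  have hα1 : α < 1 := lt_of_lt_of_le hαlt (min_le_left _ _)
  have hα7' : α < α₇ := lt_of_lt_of_le hαlt ((min_le_right _ _).trans (min_le_left _ _))
  have hα5' : α < α₅ := lt_of_lt_of_le hαlt ((min_le_right _ _).trans ((min_le_right _ _).trans (min_le_left _ _)))
  have hα6' : α < α₆ := lt_of_lt_of_le hαlt ((min_le_right _ _).trans ((min_le_right _ _).trans (min_le_right _ _)))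
  obtain ⟨c, hc, hloc⟩ := hloc α hα hα1 γ hγ hγ1
  obtain ⟨C₇, a₇, ha₇, h7⟩ := h7 α hα hα7' (Nbar + 2) Cin
  obtain ⟨C₅, a₅, ha₅, h5⟩ := h5 α hα hα5' (Nbar + 2) Cin
  set C₃ : ℝ := max C₇ C₅ with hC₃
  obtain ⟨C₆, a₆, ha₆, h6⟩ := h6 α hα hα6' Nbar Cin C₃ CH
  -- the CFL threshold: `2τ_q · (4|C₀| + |C₁|) δ_q^{1/2} λ_q ℓ^{-α} = 2(4|C₀| + |C₁|) ℓ^α ≤ c`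
  set K₀ : ℝ := 4 * |Cin 0| + |Cin 1| with hK₀
  have hK₀ : 0 ≤ K₀ := by positivity
  obtain ⟨a₈, ha₈, h8⟩ := exists_threshold_cfl (β := β) hb.le hβ.le hα hc (2 * K₀)
  refine ⟨C₆, max (max a₇ a₅) (max a₆ a₈), lt_max_of_lt_left (lt_max_of_lt_left ha₇),
    fun a ha ν hν hν1 T hT q vℓ pℓ Rℓ hNSR h213 h214 hHol => ?_⟩
  have ha7 : a₇ ≤ a := ((le_max_left _ _).trans (le_max_left _ _)).trans ha
  have ha5 : a₅ ≤ a := ((le_max_right _ _).trans (le_max_left _ _)).trans ha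
  have ha6 : a₆ ≤ a := ((le_max_left _ _).trans (le_max_right _ _)).trans ha
  have ha8 : a₈ ≤ a := ((le_max_right _ _).trans (le_max_right _ _)).trans ha
  have ha1 : 1 ≤ a := ha₇.le.trans ha7
  -- abbreviations
  set τ := glueScale β α a b q with hτdef
  set ℓ := mollScale β α a b q with hℓdef
  have hτ : 0 < τ := glueScale_pos ha1 q
  have hℓ : 0 < ℓ := mollScale_pos ha1 q
  have hℓ1 : ℓ ≤ 1 := mollScale_le_one ha1 hb.le hβ.le hα.le q
  have hA : 0 ≤ Real.sqrt (amp β a b q) * freq a b q :=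
    mul_nonneg (Real.sqrt_nonneg _) (freq_pos ha1 q).le
  -- the CFL constant `K = K₀ δ_q^{1/2} λ_q ℓ^{-α}` and `2τ K ≤ c`
  set K : ℝ := K₀ * (Real.sqrt (amp β a b q) * freq a b q * ℓ ^ (-α)) with hKdef
  have hK0 : 0 ≤ K := mul_nonneg hK₀ (mul_nonneg hA (Real.rpow_nonneg hℓ.le _))
  have hτK : 2 * τ * K ≤ c := by
    have h1 := glueScale_mul_cflBound (β := β) (α := α) (b := b) ha1 q K₀
    calc 2 * τ * K = 2 * (τ * (K₀ * (Real.sqrt (amp β a b q) * freq a b q * ℓ ^ (-α)))) := by rw [hKdef]; ring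
      _ = 2 * (K₀ * mollScale β α a b q ^ α) := by rw [hτdef, hℓdef, h1]
      _ = 2 * K₀ * mollScale β α a b q ^ α := by ring
      _ ≤ c := h8 a ha8 q
  have hsm : ∀ t ∈ Icc 0 T, FunctionSpaces.Torus.IsSmooth (vℓ t) := fun t ht =>
    hNSR.smooth_velocity.isSmooth_slice ht
  -- Step 1 (§5.2, (5.9)): the exact solutions `uⱼ` on the life spans, anchored at the left endpoints
  have hfam : ∀ i : ℕ, ∃ (w : ℝ → UnitAddTorus (Fin 3) → EuclideanSpace ℝ (Fin 3)) (π : ℝ → UnitAddTorus (Fin 3) → ℝ),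
      (i : ℝ) * τ ≤ T →
      Torus.IsFracNSReynoldsOn (glueInterval T τ i) γ ν w π (fun _ _ _ => 0) ∧
        w (max ((i : ℝ) * τ - τ) 0) = vℓ (max ((i : ℝ) * τ - τ) 0) := by
    intro i
    by_cases hi : (i : ℝ) * τ ≤ T
    · set s₀ : ℝ := max ((i : ℝ) * τ - τ) 0 with hs₀
      set b' : ℝ := min ((i : ℝ) * τ + τ) T with hb'
      have hi0 : 0 ≤ (i : ℝ) * τ := by positivity
      have hs₀T : s₀ ∈ Icc 0 T := ⟨le_max_right _ _, max_le (by linarith) hT.le⟩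
      have hsb : s₀ < b' := by
        simp only [hs₀, hb', max_lt_iff, lt_min_iff]
        exact ⟨⟨by linarith, by linarith⟩, by linarith, hT⟩
      have hlen : b' - s₀ ≤ 2 * τ := by
        have h1 : b' ≤ (i : ℝ) * τ + τ := min_le_left _ _
        have h2 : (i : ℝ) * τ - τ ≤ s₀ := le_max_left _ _
        linarith
      have hKt : FunctionSpaces.Torus.eContDiffHolderNorm 1 (Real.toNNReal α) (vℓ s₀) ≤ ENNReal.ofReal K :=
        eContDiffHolderNorm_one_le_of_holderSupLE hα hα1 hℓ hℓ1 hA hsm h213 hs₀T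
      have hT'K : (b' - s₀) * K ≤ c :=
        (mul_le_mul_of_nonneg_right hlen hK0).trans hτK
      obtain ⟨u, pu, hu, hu0⟩ := hloc ν hν s₀ (vℓ s₀) (hsm _ hs₀T) (hNSR.divFree _ hs₀T) K hK0 hKt
        (b' - s₀) (sub_pos.2 hsb) hT'K
      refine ⟨u, pu, fun _ => ⟨?_, hu0⟩⟩
      rw [glueInterval_eq_Icc, ← hs₀, ← hb']
      rwa [add_sub_cancel] at hu
    · exact ⟨fun _ _ => 0, fun _ _ => 0, fun h => absurd h hi⟩
  choose v p hvp using hfam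
  -- Step 2 (Cor. 5.2, Props. 5.3–5.4): the bounds of the family
  have hν0 : 0 ≤ ν := hν.le
  have hC7 : C₇ ≤ C₃ := le_max_left _ _
  have hC5 : C₅ ≤ C₃ := le_max_right _ _
  have hSB : ∀ i : ℕ, (i : ℝ) * τ ≤ T →
      Torus.IsFracNSReynoldsOn (glueInterval T τ i) γ ν (v i) (p i) (fun _ _ _ => 0) ∧
      v i (max ((i : ℝ) * τ - τ) 0) = vℓ (max ((i : ℝ) * τ - τ) 0) ∧
      StabilityBounds β α a b T C₃ q (Nbar + 2) i vℓ pℓ (v i) (p i) :=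
    fun i hi => ⟨(hvp i hi).1, (hvp i hi).2,
      (h7 a ha7 ν hν0 hν1.le T hT q vℓ pℓ Rℓ hNSR h213 h214 i (v i) (p i) hi (hvp i hi).1 (hvp i hi).2).mono_const ha1 hC7⟩
  have hPB : ∀ i : ℕ, ((i + 1 : ℕ) : ℝ) * τ ≤ T →
      PotentialBounds β α a b T C₃ q (Nbar + 2) i vℓ (v i) (v (i + 1)) := by
    intro i hi
    have hi' : (i : ℝ) * τ ≤ T := by
      refine le_trans ?_ hi
      push_cast
      nlinarith [hτ.le]
    exact (h5 a ha5 ν hν hν1 T hT q vℓ pℓ Rℓ hNSR h213 h214 i (v i) (p i) (v (i + 1)) (p (i + 1)) hi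
      (hvp i hi').1 (hvp i hi').2 (hvp (i + 1) hi).1 (hvp (i + 1) hi).2).mono_const ha1 hC5
  -- Step 3 (Prop. 5.5 and the glued triple): glue
  have hνabs : |ν| ≤ 1 := by rw [abs_of_pos hν]; exact hν1.le
  exact h6 a ha6 ν hνabs T hT q vℓ pℓ Rℓ hNSR h213 h214 hHol v p hSB hPB

end Reduction

end DeRosa

end Literature.Analysis.FluidPDE
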